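import Literature.NumberTheory.Irrationality.Zudilin2014.SecondTale

/-!
# Zudilin 2014, second tale: the coefficients `B_k = d/dt (R̂(t)(t+k)²)|_{t=−k}` made explicit

Topic `Literature/NumberTheory/Irrationality/Zudilin2014` [Zudilin2014ZetaTwo, Section 6, eq. (T2)–(T3a)].  The typed
`coefBT` of `SecondTale` is the quotient-rule value of `(numT·(X+k)^{2−mult})/dhatT` at `−k`.  PROVED here, for use in
the `p`-adic estimates (T3a) of `B_k` ("standard consideration; see Lemma 3 and the proof of Lemma 4 in [Zu04]"):

* `coefBT_of_simple` — at a simple pole (`mult = 1`): `B_k = numT(−k)/dhatT(−k)` (the residue);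
* `coefBT_of_double_root` — at a double pole where the numerator vanishes: `B_k = numT′(−k)/dhatT(−k)`;
* `coefBT_of_double` — at a double pole with `numT(−k) ≠ 0`:
  `B_k = A_k · (numT′/numT − dhatT′/dhatT)(−k)` (logarithmic derivative);
* evaluation of these derivatives for the products of linear factors: `eval_derivative_prodX_eq` /
  `eval_derivative_prod2X_eq` (logarithmic derivatives off the roots), `eval_derivative_prod2X_root` (at a simple
  root of the doubled block), `eval_derivative_numT_root`, `eval_derivative_numT_eq`, `eval_derivative_dhatT_eq`.

Cell pub-zeta5 (HONEST FRAMING: systematic search; no irrationality claim unless certified).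
-/

noncomputable section

open Polynomial Finset

namespace Literature.NumberTheory.Irrationality.Zudilin2014

/-! ### The three shapes of `B_k` -/

/-- At a simple pole (`mult k = 1`), `B_k = numT(−k)/dhatT(−k)`. [cite: Zudilin2014ZetaTwo, Section 6, after eq. (T2)] -/
theorem coefBT_of_simple {a b : Fin 4 → ℤ} {k : ℤ} (hm : multT a b k = 1) :
    coefBT a b k = (numT a b).eval (-(k : ℚ)) / (dhatT a b k).eval (-(k : ℚ)) := by
  unfold coefBT qpolyT
  rw [hm]
  have e1 : (derivative (numT a b * (X + C (k : ℚ)) ^ (2 - 1))).eval (-(k : ℚ)) = (numT a b).eval (-(k : ℚ)) := by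
    simp only [show (2 - 1 : ℕ) = 1 from rfl, pow_one, derivative_mul, derivative_add, derivative_X, derivative_C,
      add_zero, mul_one, eval_add, eval_mul, eval_X, eval_C, neg_add_cancel, mul_zero, zero_add]
  have e2 : (numT a b * (X + C (k : ℚ)) ^ (2 - 1)).eval (-(k : ℚ)) = 0 := by
    simp only [show (2 - 1 : ℕ) = 1 from rfl, pow_one, eval_mul, eval_add, eval_X, eval_C, neg_add_cancel, mul_zero]
  rw [e1, e2, zero_mul, sub_zero]
  by_cases hd : (dhatT a b k).eval (-(k : ℚ)) = 0
  · rw [hd]; simp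
  · rw [pow_two, mul_div_mul_right _ _ hd]

/-- At a double pole (`mult k = 2`) with `numT(−k) = 0`, `B_k = numT′(−k)/dhatT(−k)`.
[cite: Zudilin2014ZetaTwo, Section 6, after eq. (T2)] -/
theorem coefBT_of_double_root {a b : Fin 4 → ℤ} {k : ℤ} (hm : multT a b k = 2)
    (h0 : (numT a b).eval (-(k : ℚ)) = 0) :
    coefBT a b k = (derivative (numT a b)).eval (-(k : ℚ)) / (dhatT a b k).eval (-(k : ℚ)) := by
  unfold coefBT qpolyT
  rw [hm]
  simp only [Nat.sub_self, pow_zero, mul_one, h0, zero_mul, sub_zero]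
  by_cases hd : (dhatT a b k).eval (-(k : ℚ)) = 0
  · rw [hd]; simp
  · rw [pow_two, mul_div_mul_right _ _ hd]

/-- At a double pole with `numT(−k) ≠ 0` (and `dhatT(−k) ≠ 0`), the logarithmic-derivative form
`B_k = A_k · (numT′(−k)/numT(−k) − dhatT′(−k)/dhatT(−k))`. [cite: Zudilin2014ZetaTwo, Section 6, eq. (T3a)] -/
theorem coefBT_of_double {a b : Fin 4 → ℤ} {k : ℤ} (hm : multT a b k = 2)
    (hn : (numT a b).eval (-(k : ℚ)) ≠ 0) (hd : (dhatT a b k).eval (-(k : ℚ)) ≠ 0) :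
    coefBT a b k = coefAT a b k * ((derivative (numT a b)).eval (-(k : ℚ)) / (numT a b).eval (-(k : ℚ))
      - (derivative (dhatT a b k)).eval (-(k : ℚ)) / (dhatT a b k).eval (-(k : ℚ))) := by
  unfold coefBT coefAT qpolyT
  rw [hm]
  simp only [Nat.sub_self, pow_zero, mul_one]
  field_simp

/-! ### Derivatives of products of linear factors -/

/-- Logarithmic derivative of `∏_{i∈s} (X + i)` off its roots. [cite: Zudilin2014ZetaTwo, Section 6, eq. (T3a)] -/
theorem eval_derivative_prodX_eq (s : Finset ℤ) {x : ℚ} (hx : ∀ i ∈ s, x + i ≠ 0) :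
    (derivative (∏ i ∈ s, (X + C (i : ℚ)))).eval x = (∏ i ∈ s, (x + i)) * ∑ i ∈ s, 1 / (x + i) := by
  rw [derivative_prod_finset, eval_finsetSum, mul_sum]
  refine sum_congr rfl fun i hi => ?_
  rw [eval_mul, derivative_add, derivative_X, derivative_C, add_zero, eval_one, mul_one, eval_prod,
    ← mul_prod_erase s (fun j : ℤ => x + (j : ℚ)) hi]
  simp only [eval_add, eval_X, eval_C]
  field_simp [hx i hi]

/-- Logarithmic derivative of the doubled block `∏_{ℓ∈s} (2X + ℓ)` off its roots.
[cite: Zudilin2014ZetaTwo, Section 6, eq. (T3a)] -/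
theorem eval_derivative_prod2X_eq (s : Finset ℤ) {x : ℚ} (hx : ∀ l ∈ s, 2 * x + l ≠ 0) :
    (derivative (∏ l ∈ s, (C (2 : ℚ) * X + C (l : ℚ)))).eval x
      = (∏ l ∈ s, (2 * x + l)) * ∑ l ∈ s, 2 / (2 * x + l) := by
  rw [derivative_prod_finset, eval_finsetSum, mul_sum]
  refine sum_congr rfl fun l hl => ?_
  rw [eval_mul, derivative_add, derivative_C_mul, derivative_X, derivative_C, add_zero, mul_one, eval_C,
    eval_prod, ← mul_prod_erase s (fun j : ℤ => 2 * x + (j : ℚ)) hl]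
  simp only [eval_add, eval_mul, eval_X, eval_C]
  field_simp [hx l hl]

/-- At a simple root `ℓ₀ ∈ s` of the doubled block (`2x + ℓ₀ = 0`):
`(∏_{ℓ∈s}(2X+ℓ))′(x) = 2 ∏_{ℓ ≠ ℓ₀} (2x + ℓ)`. [cite: Zudilin2014ZetaTwo, Section 6, eq. (T3a)] -/
theorem eval_derivative_prod2X_root (s : Finset ℤ) {x : ℚ} {l₀ : ℤ} (hl₀ : l₀ ∈ s) (hx : 2 * x + l₀ = 0) :
    (derivative (∏ l ∈ s, (C (2 : ℚ) * X + C (l : ℚ)))).eval x = 2 * ∏ l ∈ s.erase l₀, (2 * x + l) := by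
  rw [derivative_prod_finset, eval_finsetSum, ← add_sum_erase s _ hl₀]
  have hrest : ∑ l ∈ s.erase l₀, ((∏ j ∈ (s.erase l), (C (2 : ℚ) * X + C (j : ℚ))) *
      derivative (C (2 : ℚ) * X + C (l : ℚ))).eval x = 0 := by
    refine sum_eq_zero fun l hl => ?_
    have hl' : l₀ ∈ s.erase l := mem_erase.2 ⟨(ne_of_mem_erase hl).symm, hl₀⟩
    rw [eval_mul, eval_prod, prod_eq_zero hl' (by simp [hx]), zero_mul]
  rw [hrest, add_zero, eval_mul, derivative_add, derivative_C_mul, derivative_X, derivative_C, add_zero, mul_one,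
    eval_C, eval_prod, mul_comm]
  congr 1
  exact prod_congr rfl fun l _ => by simp

/-- Derivative of `numT` at a simple root of the doubled block: if `2k ∈ [b̂₀, â₀)` then
`numT′(−k) = Π̂ · 2∏_{ℓ≠2k}(ℓ − 2k) · ∏_{i∈[b̂₁,â₁)}(i − k)`. [cite: Zudilin2014ZetaTwo, Section 6, eq. (T3a)] -/
theorem eval_derivative_numT_root {a b : Fin 4 → ℤ} {k : ℤ} (hk : 2 * k ∈ Ico (b 0) (a 0)) :
    (derivative (numT a b)).eval (-(k : ℚ))
      = normT a b * (2 * ∏ l ∈ (Ico (b 0) (a 0)).erase (2 * k), ((l : ℚ) - 2 * k))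
        * ∏ i ∈ Ico (b 1) (a 1), ((i : ℚ) - k) := by
  have hroot : 2 * (-(k : ℚ)) + ((2 * k : ℤ) : ℚ) = 0 := by push_cast; ring
  have hb2 : (block2 (b 0) (a 0)).eval (-(k : ℚ)) = 0 := by
    rw [eval_block2]; exact prod_eq_zero hk hroot
  have hd2 : (derivative (block2 (b 0) (a 0))).eval (-(k : ℚ))
      = 2 * ∏ l ∈ (Ico (b 0) (a 0)).erase (2 * k), ((l : ℚ) - 2 * k) := by
    unfold block2
    rw [eval_derivative_prod2X_root _ hk hroot]
    congr 1
    exact prod_congr rfl fun l _ => by ring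
  have hb1 : (block (b 1) (a 1)).eval (-(k : ℚ)) = ∏ i ∈ Ico (b 1) (a 1), ((i : ℚ) - k) := by
    rw [eval_block]; exact prod_congr rfl fun i _ => by ring
  unfold numT
  rw [derivative_mul, derivative_C, zero_mul, zero_add, derivative_mul, eval_mul, eval_C, eval_add, eval_mul,
    eval_mul, hb2, zero_mul, add_zero, hd2, hb1]
  ring

/-- Logarithmic derivative of `numT` off its roots:
`numT′(−k) = numT(−k) · (Σ_ℓ 2/(ℓ−2k) + Σ_i 1/(i−k))`. [cite: Zudilin2014ZetaTwo, Section 6, eq. (T3a)] -/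
theorem eval_derivative_numT_eq {a b : Fin 4 → ℤ} {k : ℤ} (h0 : ∀ l ∈ Ico (b 0) (a 0), l ≠ 2 * k)
    (h1 : ∀ i ∈ Ico (b 1) (a 1), i ≠ k) :
    (derivative (numT a b)).eval (-(k : ℚ))
      = (numT a b).eval (-(k : ℚ)) * (∑ l ∈ Ico (b 0) (a 0), 2 / ((l : ℚ) - 2 * k)
        + ∑ i ∈ Ico (b 1) (a 1), 1 / ((i : ℚ) - k)) := by
  have hx0 : ∀ l ∈ Ico (b 0) (a 0), 2 * (-(k : ℚ)) + l ≠ 0 := fun l hl h => h0 l hl (by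
    have : ((l : ℤ) : ℚ) = ((2 * k : ℤ) : ℚ) := by push_cast; linarith
    exact_mod_cast this)
  have hx1 : ∀ i ∈ Ico (b 1) (a 1), -(k : ℚ) + i ≠ 0 := fun i hi h => h1 i hi (by
    have : ((i : ℤ) : ℚ) = k := by linarith
    exact_mod_cast this)
  have h2 : (derivative (block2 (b 0) (a 0))).eval (-(k : ℚ))
      = (block2 (b 0) (a 0)).eval (-(k : ℚ)) * ∑ l ∈ Ico (b 0) (a 0), 2 / ((l : ℚ) - 2 * k) := by
    rw [eval_block2]; unfold block2
    rw [eval_derivative_prod2X_eq _ hx0]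
    congr 1
    exact sum_congr rfl fun l _ => by ring
  have h1 : (derivative (block (b 1) (a 1))).eval (-(k : ℚ))
      = (block (b 1) (a 1)).eval (-(k : ℚ)) * ∑ i ∈ Ico (b 1) (a 1), 1 / ((i : ℚ) - k) := by
    rw [eval_block]; unfold block
    rw [eval_derivative_prodX_eq _ hx1]
    congr 1
    exact sum_congr rfl fun i _ => by ring
  have hd : derivative (numT a b) = C (normT a b) * (derivative (block2 (b 0) (a 0)) * block (b 1) (a 1)
      + block2 (b 0) (a 0) * derivative (block (b 1) (a 1))) := by
    unfold numT; rw [derivative_mul, derivative_C, zero_mul, zero_add, derivative_mul]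
  rw [hd, eval_mul, eval_C, eval_add, eval_mul, eval_mul, h2, h1]
  unfold numT
  rw [eval_mul, eval_C, eval_mul]
  ring

/-- Logarithmic derivative of `dhatT` at `−k` (no factor vanishes there):
`dhatT′(−k) = dhatT(−k) · (Σ_{i∈[â₂,b̂₂)∖k} 1/(i−k) + Σ_{i∈[â₃,b̂₃)∖k} 1/(i−k))`.
[cite: Zudilin2014ZetaTwo, Section 6, eq. (T3a)] -/
theorem eval_derivative_dhatT_eq (a b : Fin 4 → ℤ) (k : ℤ) :
    (derivative (dhatT a b k)).eval (-(k : ℚ))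
      = (dhatT a b k).eval (-(k : ℚ)) * (∑ i ∈ (Ico (a 2) (b 2)).erase k, 1 / ((i : ℚ) - k)
        + ∑ i ∈ (Ico (a 3) (b 3)).erase k, 1 / ((i : ℚ) - k)) := by
  have hx : ∀ (s : Finset ℤ), ∀ i ∈ s.erase k, -(k : ℚ) + i ≠ 0 := fun s i hi h => ne_of_mem_erase hi (by
    have : ((i : ℤ) : ℚ) = k := by linarith
    exact_mod_cast this)
  have hP : ∀ s : Finset ℤ, (∀ i ∈ s, -(k : ℚ) + i ≠ 0) →
      (derivative (∏ i ∈ s, (X + C (i : ℚ)))).eval (-(k : ℚ))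
        = (∏ i ∈ s, (X + C (i : ℚ))).eval (-(k : ℚ)) * ∑ i ∈ s, 1 / ((i : ℚ) - k) := by
    intro s hs
    rw [eval_derivative_prodX_eq _ hs, eval_prod]
    congr 1
    · exact prod_congr rfl fun i _ => by simp
    · exact sum_congr rfl fun i _ => by ring
  unfold dhatT
  rw [derivative_mul, eval_add, eval_mul, eval_mul, hP _ (hx _), hP _ (hx _), eval_mul]
  ring

end Literature.NumberTheory.Irrationality.Zudilin2014

end
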